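import Literature.NumberTheory.EllipticCurves.ZpExtensionInertiaTorsionCyclotomicProofs
import Literature.NumberTheory.EllipticCurves.GreenbergSelmer
import HarnessLib

/-!
# A prime above a SPLIT `p` of a quadratic field does NOT split in the cyclotomic `ℤ_p`-extension:
# `κ(I_w) = κ(D_w) = Γ` (proofs only)

Topic `NumberTheory/EllipticCurves` (namespace `Literature.NumberTheory.EllipticCurves.ZpExtension`).  THEOREMS ONLY (no definition,
no named fact, no instance, no `sorry`).  For a quadratic field `K`, a prime `p` that SPLITS in `K` (`w ≠ v` both above `p`) and the
CYCLOTOMIC `ℤ_p`-extension `κ` of `K` (`ker κ = χ_p⁻¹(μ(ℤ_p))`, the tree's `ZpExtension.IsCyclotomic`):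

* `IsCyclotomic.apply_eq_of_cyclotomicCharacter_eq` — `κ` factors through the cyclotomic character: `χ_p σ = χ_p τ ⟹ κ σ = κ τ`
  (any field `K`).
* `IsCyclotomic.exists_mem_inertia_apply_eq_of_split` — **`κ(I_w) = ℤ_p`**: every value of `κ` is taken on the INERTIA group
  `I_w ≤ Γ_K` of the tree's chosen prime above `w` (`GreenbergSelmer.inertia w`); i.e. `w` is TOTALLY RAMIFIED in `K_∞/K`.  Proof: the
  tree's `exists_mem_inertia_cyclotomicCharacter_eq_of_split` (`χ_p(I_𝔓) = ℤ_pˣ` above a split prime of a quadratic field, Neukirch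
  II (7.13)) at `𝔓₀ = adicCompletionPrime K w`, whose inertia group is `res (I_{K_w})` (`inertia_adicCompletionPrime_eq_map_absInertia`).
* `IsCyclotomic.exists_mem_decomp_apply_eq_of_split` — the same on the decomposition group `D_w` («`w` does not split at all in
  `K_∞/K`», the hypothesis `hsurjw` of `Summits/…/TwoAdicConverseOrdLambdaHalfAtTwoGL1ResidualLineCount` §3), and
  `IsCyclotomic.surjective_comp_absGaloisRestrict_adicCompletion_of_split` — the same as surjectivity of `κ ∘ res_w : Γ_{K_w} → ℤ_p`
  (the shape `AcSigned.IsNonsplitIn κ w`, flag `localize-nonsplit`, for the CYCLOTOMIC line at a split prime).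

In print: Washington §13.1 («the primes above `p` are totally ramified in `ℚ_∞/ℚ`») with `K_w = ℚ_p`; Greenberg LNM 1716 §1 («`v` is
finitely decomposed in `F_∞/F`»); used for the Greenberg field of line `kato_determinant_greenberg_two` (crux `OrdLambdaHalfAtTwo`,
`p = 2` split in an imaginary quadratic `K`).  What is NOT here: primes above a non-split `p`, general number fields, the anticyclotomic
line (tree: `isNonsplitIn_of_isAnticyclotomic_of_not_dvd_classNumber`).

References: [Washington1997] §13.1; [GreenbergLNM1716] §1; [NeukirchANT1999] II (7.13), II §9 (9.6).
-/

noncomputable section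

open Field NumberField IsDedekindDomain
open Literature.NumberTheory.GaloisRepresentations Literature.NumberTheory.EllipticCurves

namespace Literature.NumberTheory.EllipticCurves.ZpExtension

variable {K : Type} [Field K] [NumberField K] {p : ℕ} [Fact p.Prime]

omit [NumberField K] in
/-- **A cyclotomic `ℤ_p`-extension factors through the cyclotomic character**: if `ker κ = χ_p⁻¹(μ(ℤ_p))` then
`χ_p σ = χ_p τ ⟹ κ σ = κ τ` (indeed `χ_p(τ⁻¹σ) = 1` is torsion). [cite: Washington1997, §13.1] -/
theorem IsCyclotomic.apply_eq_of_cyclotomicCharacter_eq {κ : ZpExtension K p} (hκ : κ.IsCyclotomic)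
    {σ τ : absoluteGaloisGroup K}
    (h : GaloisRep.cyclotomicCharacter K p σ = GaloisRep.cyclotomicCharacter K p τ) : κ σ = κ τ := by
  have hmem : τ⁻¹ * σ ∈ κ.kerSubgroup := by
    rw [hκ, Subgroup.mem_comap]
    change GaloisRep.cyclotomicCharacter K p (τ⁻¹ * σ) ∈ CommGroup.torsion ℤ_[p]ˣ
    rw [map_mul, map_inv, h, inv_mul_cancel]
    exact Subgroup.one_mem _
  have h1 : κ (τ⁻¹ * σ) = 1 := mem_kerSubgroup.mp hmem
  rw [map_mul, map_inv, inv_mul_eq_one] at h1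
  exact h1.symm

/-- **`κ(I_w) = ℤ_p` above a split prime of a quadratic field** (`w` is totally ramified in the cyclotomic `ℤ_p`-extension): for
`[K : ℚ] = 2`, `w ≠ v` above `p`, `κ` cyclotomic and any `g ∈ ℤ_p` there is `δ` in the inertia group `I_w ≤ Γ_K` of the tree's chosen prime
above `w` (`GreenbergSelmer.inertia w = res (I_{K_w})`) with `κ δ = g`. [cite: Washington1997, §13.1] [cite: NeukirchANT1999, Ch. II (7.13) and §9 Prop. (9.6)] -/
theorem IsCyclotomic.exists_mem_inertia_apply_eq_of_split (hK2 : Module.finrank ℚ K = 2) {κ : ZpExtension K p}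
    (hκ : κ.IsCyclotomic) {w v : HeightOneSpectrum (𝓞 K)} (hpw : ((p : ℕ) : 𝓞 K) ∈ w.asIdeal)
    (hpv : ((p : ℕ) : 𝓞 K) ∈ v.asIdeal) (hne : w ≠ v) (g : Multiplicative ℤ_[p]) :
    ∃ δ ∈ GreenbergSelmer.inertia w, κ δ = g := by
  obtain ⟨σ, hσ⟩ := κ.surjective g
  obtain ⟨τ, hτI, hτ⟩ := exists_mem_inertia_cyclotomicCharacter_eq_of_split hK2 hpv hpw hne
    (adicCompletionPrime_mem_primesAbove K w) (GaloisRep.cyclotomicCharacter K p σ)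
  refine ⟨τ, ?_, ?_⟩
  · change τ ∈ (absInertia (w.adicCompletion K)).map (absGaloisRestrict K (w.adicCompletion K)).toMonoidHom
    rw [← inertia_adicCompletionPrime_eq_map_absInertia]
    exact hτI
  · rw [hκ.apply_eq_of_cyclotomicCharacter_eq hτ]
    exact hσ

/-- **`κ(D_w) = ℤ_p` above a split prime of a quadratic field** («`w` does not split at all in the cyclotomic `K_∞/K`»; the hypothesis
`hsurjw` of the one-place GL(1) sandwich of crux `OrdLambdaHalfAtTwo`): for `[K : ℚ] = 2`, `w ≠ v` above `p`, `κ` cyclotomic, every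
`g ∈ ℤ_p` is `κ δ` for some `δ` in the decomposition group `D_w` (`GreenbergSelmer.decomp w`). [cite: Washington1997, §13.1] [cite: GreenbergLNM1716, §1] -/
theorem IsCyclotomic.exists_mem_decomp_apply_eq_of_split (hK2 : Module.finrank ℚ K = 2) {κ : ZpExtension K p}
    (hκ : κ.IsCyclotomic) {w v : HeightOneSpectrum (𝓞 K)} (hpw : ((p : ℕ) : 𝓞 K) ∈ w.asIdeal)
    (hpv : ((p : ℕ) : 𝓞 K) ∈ v.asIdeal) (hne : w ≠ v) :
    ∀ g : Multiplicative ℤ_[p], ∃ δ ∈ GreenbergSelmer.decomp w, κ δ = g := fun g ↦ by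
  obtain ⟨δ, hδ, h⟩ := hκ.exists_mem_inertia_apply_eq_of_split hK2 hpw hpv hne g
  exact ⟨δ, GreenbergSelmer.inertia_le_decomp w hδ, h⟩

/-- **`κ ∘ res_w : Γ_{K_w} → ℤ_p` is onto above a split prime of a quadratic field** (the `IsNonsplitIn` shape, for the CYCLOTOMIC
line; `res_w = absGaloisRestrict K K_w` for the tree's chosen embedding). [cite: Washington1997, §13.1] [cite: GreenbergLNM1716, §1] -/
theorem IsCyclotomic.surjective_comp_absGaloisRestrict_adicCompletion_of_split (hK2 : Module.finrank ℚ K = 2)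
    {κ : ZpExtension K p} (hκ : κ.IsCyclotomic) {w v : HeightOneSpectrum (𝓞 K)} (hpw : ((p : ℕ) : 𝓞 K) ∈ w.asIdeal)
    (hpv : ((p : ℕ) : 𝓞 K) ∈ v.asIdeal) (hne : w ≠ v) :
    Function.Surjective (κ.toContinuousMonoidHom.comp (absGaloisRestrict K (w.adicCompletion K))) := fun g ↦ by
  obtain ⟨δ, hδ, h⟩ := hκ.exists_mem_decomp_apply_eq_of_split hK2 hpw hpv hne g
  obtain ⟨σ, rfl⟩ := (GreenbergSelmer.mem_decomp_iff w δ).mp hδ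
  exact ⟨σ, h⟩

end Literature.NumberTheory.EllipticCurves.ZpExtension

end
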